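import Summits.BirchSwinnertonDyer.BirchSwinnertonDyer.Theorems.AdditiveBranchIMCGordTwoTwistedChainR0Two
import HarnessLib

/-!
# Route `AdditiveBranchIMC`, crux `GordTwoRankZeroOffCaseOne` (19357), line `three_field_road` — DOOR T (director (811), LeadReport29 §5):
# FIELDS 2–3 OF THE r₀ ROAD WITHOUT THE TAMAGAWA CLAUSE, GIVEN THE NAMED RESEARCH STATEMENT J (LEAD g20; `--supports` 19357, helper only)

Theorems only (no definition, no named fact, no `sorry`); nothing about BSD is asserted; the crux stays OPEN; BSD is proved for no curve.
LeadReport29 (crux dir, 7a741266b046b4b9) located the r₀ row clause `p ∤ ∏ c_ℓ(E)` at exactly ONE place of the road: FIELD 2, the genus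
joint upper half `ThreeFieldRowClosed.jointUpperBoundAt_genus` (its two uses: McCallum's non-split Selmer clause at `v ∣ N` with
`p ∣ ord_v Δ`, and the genus Gross–Zagier valuation identity). The director's word (811) registers the Tamagawa-free statement of that
field as the NAMED RESEARCH STATEMENT

  J := `jointUpperBoundAt_genus` with its binders `htamd : p ∤ ∏c(Wd)`, `htamA : p ∤ ∏c(A)` (and the nine printed facts, supplied by
  the consumer) DELETED — for a rank-one `Wd` on cell (G-ord, `e = 2`) with `ρ̄` onto (`p ≥ 5`), a `p`-ramified Kolyvagin field `K″`
  with a free ramified prime and the good-ordinary rank-zero partner `A ≅ Wd^{(d_{K″})}`: `SchneiderFree.Upper.JointUpperBoundAt Wd A p`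
  (`ord_p #Ш(Wd) + ord_p #Ш(A) ≤ ord_p #Ш_an(Wd) + ord_p #Ш_an(A)`). Equivalently (given the valuation identity generalised): W. Zhang's
  REFINED (Tamagawa-exact) KOLYVAGIN CONJECTURE for the GENUS-transported Heegner system at `p ∣ d_{K″}`, `p² ∣ N_{Wd}`. NOT IN PRINT
  at `p ∣ d_K` (print: Jetchev 2008 Thm. 1.4 / Cor. 1.5 — `p ∤ N`, trivial character, `max_ℓ ord_p c_ℓ` only; JSW 2017 Thm. 3.3.1 /
  BCGS 2023 Thm. 2 — good ordinary `p` split in `K`); research.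

In this file J is an EXPLICIT HYPOTHESIS `hJ` (spelled out over existing declarations; never a Literature fact, never consumed as proved),
exactly as 19359's `hAFC`. Contents:
* `exists_genusField_rankOne_noTam` — the genus-field supply for a rank-one curve (`GenusFieldRankOne.exists_genusField_rankOne`, LEAD
  g12) WITHOUT its Tamagawa input/output (the landed proof with the `htamA` block removed): Hoffstein–Luo through
  `exists_ramifiedAt_splitAt_twist_ne_zero_of_rootNumber_twist` with the ramified prime `:= p` and the cell's root-number engine;
* `missingUpperBoundAt_of_genusData_tamFree` — given J, the genus-road data `(K″, A)` of ANY of the road's FIELD-2 supplies, and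
  Skinner–Urban 2014 Thm. 2 for the partner (FIELD 3): `MissingUpperBoundAt Wd p`, no Tamagawa clause;
* `missingUpperBoundAt_rankOne_of_genusTamFree` — the same for a rank-one `Wd` carrying its OWN Skinner–Urban prime (supply =
  `exists_genusField_rankOne_noTam`): the door-D / door-C shape.
Consumers: `…GenusTamagawaFreeChainsA/B` (the four sub-rows re-closed without `htam`, modulo print + J) and skeleton v48's
`stub_genusJointUpperTamFreeR0`. References: [cite: Jetchev2008, Thm. 1.4 and Cor. 1.5 (p. 812)] [cite: JetchevSkinnerWan2017, Thm. 3.3.1]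
[cite: SkinnerUrban2014, Thm. 2 (a)] [cite: HoffsteinLuo1997, Theorem (§1)] [cite: Kolyvagin1990, Thm. A].
presearch: «Kolyvagin bound sharpened by all Tamagawa numbers / refined Kolyvagin conjecture at p ∣ d_K» → [corpus:paper-arxiv-2312.09301
p.4–5] BCGS 2023 Thm. 2 (good ordinary p split); [corpus:paper-arxiv-math_0703431 p.3, 13–17] Jetchev (p ∤ N, max); none at p ∣ d_K
(corpus + galaxy).
-/

set_option autoImplicit false
set_option linter.dupNamespace false

noncomputable section

open scoped Classical NumberTheorySymbols

open WeierstrassCurve IsDedekindDomain IsDedekindDomain.HeightOneSpectrum NumberField Rat.HeightOneSpectrum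
  Literature.NumberTheory.EllipticCurves Literature.NumberTheory.EllipticCurves.ModularForms
  Literature.NumberTheory.EllipticCurves.Rank1Residual Literature.NumberTheory.QuadraticFields
  Literature.NumberTheory.EllipticCurves.Rank1Residual.Typed
  Summit.BirchSwinnertonDyer.Rank1Residual Summit.BirchSwinnertonDyer.Rank1Residual.Additive
  Summit.BirchSwinnertonDyer.BirchSwinnertonDyer.Theorems

namespace Summit.BirchSwinnertonDyer.BirchSwinnertonDyer.Theorems.GenusTamagawaFree

open ThreeFieldRoadSupply WanAnyRoad TwistedWanRoad GenusFieldRankOne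

/-! ### §1 The genus-field supply for a rank-one curve, without Tamagawa in- or output -/

open Literature.NumberTheory.QuadraticFields Literature.NumberTheory.EllipticCurves.Castella2018.TamagawaQuadratic in
/-- **The genus-field supply for a rank-one curve, Tamagawa-free** — `GenusFieldRankOne.exists_genusField_rankOne` (LEAD g12) without the
hypothesis `p ∤ ∏ c_ℓ(E)` and without the conclusion `p ∤ ∏ c_ℓ(A)` (its only use); the proof is the landed one with that block removed. For
`E/ℚ` (globally minimal `W`) with `w(E) = −1`, `(E, p)` on cell (G-ord, `e = 2`), `p ≥ 5`, `ρ̄_{E,p}` onto, and a multiplicative prime `q ≠ p`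
with `p ∤ v_q(Δ)`: an imaginary quadratic `K″` with `p ∣ d_{K″}`, every prime of `N_E` other than `p` split (so `(E, A, K″)` is a `p`-ramified
Kolyvagin datum, the Birch clause being vacuous), a free ramified prime `ℓ ∣ d_{K″}`, `ℓ ∤ pN_E`, and a globally minimal `A ≅ E^{(d_{K″})}` with
`r_an(A) = 0`, good ordinary at `p`, `ρ̄_{A,p}` onto, multiplicative at `q` with `p ∤ v_q(Δ_A)`.
[cite: HoffsteinLuo1997, Theorem (§1, pp. 435–436)] [cite: SilvermanAEC2009, X.5 Cor. 5.4, VII.5.1 and Thm VII.6.1]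
[cite: GrossLMS1991, §1 (Birch's Heegner condition)] -/
theorem exists_genusField_rankOne_noTam (W : WeierstrassCurve ℚ) [W.IsElliptic] [W.IsGloballyMinimal] (p : ℕ) [hp : Fact p.Prime]
    (hmod : exists_isNewformOf) (hL : hasEntireLFunction_rat)
    (hHL : HoffsteinLuo1997_exists_twist_L_one_ne_zero)
    (hp5 : 5 ≤ p) (hw : W.rootNumber = -1) (hcell : N10.CellGordTwo W p) (hsurj : Surj W p)
    {q : ℕ} [hq : Fact q.Prime] (hqp : q ≠ p) (hqm : W.HasMultiplicativeReductionAtPrime q)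
    (hqv : ¬ p ∣ padicValInt q W.minimalDiscriminantInt) :
    ∃ (K'' : Type) (_ : Field K'') (_ : NumberField K'')
      (A : WeierstrassCurve ℚ) (_ : A.IsElliptic) (_ : A.IsGloballyMinimal),
      RamifiedKolyvaginField W A p K'' ∧
      (∃ ℓ : ℕ, ℓ.Prime ∧ (ℓ : ℤ) ∣ NumberField.discr K'' ∧ ℓ ≠ p ∧ ¬ ℓ ∣ W.conductorNorm ℤ) ∧
      (∃ C : VariableChange ℚ, C • W.quadraticTwist (NumberField.discr K'' : ℚ) = A) ∧
      A.analyticRank = 0 ∧ GoodOrd A p ∧ Surj A p ∧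
      (∃ ℓ : ℕ, ∃ _ : Fact ℓ.Prime, ℓ ≠ p ∧ A.HasMultiplicativeReductionAtPrime ℓ ∧
        ¬ p ∣ padicValInt ℓ A.minimalDiscriminantInt) := by
  have hp2 : p ≠ 2 := by omega
  have hp0 : (p : ℚ) ≠ 0 := by exact_mod_cast hp.out.ne_zero
  obtain ⟨K'', iF, iN, hK, hB, hpD, hsplit, h2, -, hLne⟩ :=
    exists_ramifiedAt_splitAt_twist_ne_zero_of_rootNumber_twist W hmod hHL hw p hp2
      (fun ℓ hℓ _ hlt hℓg h8 hj ↦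
        rootNumber_quadraticTwist_mul_eq_of_cellGordTwo W p hmod hp5 hcell hℓ (Nat.ne_of_lt hlt) hℓg h8 hj)
      q hq.out hqp p
  have h2K : Module.finrank ℚ K'' = 2 := hK.1
  have h2split : ((Ideal.span {(2 : ℤ)}).primesOver (𝓞 K'')).ncard = 2 := by
    by_cases h2N : 2 ∣ W.conductorNorm ℤ
    · exact hsplit 2 Nat.prime_two h2N (fun h ↦ hp2 h.symm)
    · exact h2 h2N
  have hHeeg : ∀ ℓ : ℕ, ℓ.Prime → ℓ ∣ W.conductorNorm ℤ → ℓ ≠ p → SatisfiesHeegnerHypothesis ℓ K'' := by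
    intro ℓ hℓ hℓN hℓp r hr hrℓ
    obtain rfl : r = ℓ := (Nat.prime_dvd_prime_iff_eq hr hℓ).mp hrℓ
    exact hsplit r hr hℓN hℓp
  have hHeeg2 : SatisfiesHeegnerHypothesis 2 K'' := fun r hr hr2 ↦ by
    obtain rfl : r = 2 := (Nat.prime_dvd_prime_iff_eq hr Nat.prime_two).mp hr2
    exact h2split
  have hD8 : NumberField.discr K'' % 8 = 1 :=
    ((satisfiesHeegnerHypothesis_iff_kronecker 2 K'' h2K).mp hHeeg2 2 Nat.prime_two dvd_rfl).1 rfl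
  have hD4 : NumberField.discr K'' % 4 = 1 := by omega
  have hDsq : Squarefree (NumberField.discr K'') := by
    rcases Quadratic.isFundamentalDiscriminant_discr (K := K'') h2K with ⟨-, hsq, -⟩ | ⟨h4, -, -⟩
    · exact hsq
    · exfalso; obtain ⟨k, hk⟩ := h4; omega
  have hD1 : NumberField.discr K'' ≠ 1 := by omega
  have hD0 : NumberField.discr K'' ≠ 0 := by omega
  have hDq : ((NumberField.discr K'' : ℤ) : ℚ) ≠ 0 := by exact_mod_cast hD0
  have hkr : ∀ ℓ : ℕ, ℓ.Prime → ℓ ∣ W.conductorNorm ℤ → ℓ ≠ p →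
      (ℓ = 2 → NumberField.discr K'' % 8 = 1) ∧ (ℓ ≠ 2 → jacobiSym (NumberField.discr K'') ℓ = 1) :=
    fun ℓ hℓ hℓN hℓp ↦ (satisfiesHeegnerHypothesis_iff_kronecker ℓ K'' h2K).mp (hHeeg ℓ hℓ hℓN hℓp) ℓ hℓ dvd_rfl
  have hsqD : ∀ ℓ : ℕ, (hℓ : ℓ.Prime) → ℓ ∣ W.conductorNorm ℤ → ℓ ≠ p →
      (haveI : Fact ℓ.Prime := ⟨hℓ⟩; IsSquare (((NumberField.discr K'' : ℤ) : ℚ) : ℚ_[ℓ])) := by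
    intro ℓ hℓ hℓN hℓp
    haveI : Fact ℓ.Prime := ⟨hℓ⟩
    exact isSquare_padic_of_fundamental hD4 hDsq hD1 (hkr ℓ hℓ hℓN hℓp)
  have hndvd : ∀ ℓ : ℕ, ℓ.Prime → ℓ ∣ W.conductorNorm ℤ → ℓ ≠ p → ¬ (ℓ : ℤ) ∣ NumberField.discr K'' := by
    intro ℓ hℓ hℓN hℓp hℓD
    by_cases hℓ2 : ℓ = 2
    · subst hℓ2
      obtain ⟨k, hk⟩ := hℓD
      omega
    · have h1 := (hkr ℓ hℓ hℓN hℓp).2 hℓ2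
      rw [jacobiSym.mod_left, Int.emod_eq_zero_of_dvd hℓD, jacobiSym.zero_left hℓ.one_lt] at h1
      exact zero_ne_one h1
  obtain ⟨m, hm⟩ := hpD
  have hpD' : (p : ℤ) ∣ NumberField.discr K'' := ⟨m, hm⟩
  have hpm : ¬ (p : ℤ) ∣ m := by
    rintro ⟨k, rfl⟩
    have hu := hDsq (p : ℤ) ⟨k, by rw [hm]; ring⟩
    rcases Int.isUnit_iff.mp hu with h | h <;> omega
  have hfree : ∃ ℓ : ℕ, ℓ.Prime ∧ (ℓ : ℤ) ∣ NumberField.discr K'' ∧ ℓ ≠ p ∧ ¬ ℓ ∣ W.conductorNorm ℤ := by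
    have habs : (NumberField.discr K'').natAbs = p * m.natAbs := by
      rw [hm, Int.natAbs_mul, Int.natAbs_natCast]
    have hm1 : m.natAbs ≠ 1 := by
      intro h1
      have hB' := hB
      rw [habs, h1, mul_one] at hB'
      exact lt_irrefl _ hB'
    obtain ⟨r, hr, hrm⟩ := Nat.exists_prime_and_dvd hm1
    have hrm' : (r : ℤ) ∣ m := Int.natCast_dvd.mpr hrm
    have hrD : (r : ℤ) ∣ NumberField.discr K'' := by rw [hm]; exact hrm'.mul_left _
    have hrp : r ≠ p := by
      rintro rfl
      exact hpm hrm'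
    exact ⟨r, hr, hrD, hrp, fun hrN ↦ hndvd r hr hrN hrp hrD⟩
  obtain ⟨A, iA, iAm, CA, hCA⟩ := exists_isGloballyMinimal_smul_eq_quadraticTwist W hDq
  have hA : CA⁻¹ • W.quadraticTwist ((NumberField.discr K'' : ℤ) : ℚ) = A := by rw [← hCA, inv_smul_smul]
  have hrA : A.analyticRank = 0 := analyticRank_eq_zero_tameTwist W K'' hL CA⁻¹ hA hLne
  have hsurjA : Surj A p := surj_tameTwist W p K'' CA⁻¹ hA hsurj
  obtain ⟨V, iV, iVm, CV, -, hordV, ⟨C', hC'⟩, hcond, hpN, -⟩ :=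
    ThreeFieldRoadSupply.exists_goodOrd_partner_rootNumber W p hmod hp5 hcell
  have hmsq : Squarefree m := hDsq.squarefree_of_dvd ⟨p, by rw [hm]; ring⟩
  have htsq : Squarefree ((-1 : ℤ) ^ (p / 2) * m) := by
    rcases neg_one_pow_eq_or ℤ (p / 2) with h | h <;> rw [h]
    · simpa using hmsq
    · simpa using hmsq.squarefree_of_dvd (neg_dvd.mpr (dvd_refl m))
  have hpt : ¬ (p : ℤ) ∣ (-1 : ℤ) ^ (p / 2) * m := by
    intro h
    apply hpm
    rcases neg_one_pow_eq_or ℤ (p / 2) with h1 | h1 <;> rw [h1] at h <;> simpa using h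
  have hgoA : GoodOrd A p := by
    obtain ⟨Cy, hCy⟩ := V.exists_variableChange_quadraticTwist_mul_sq ((((-1 : ℤ) ^ (p / 2) * m : ℤ) : ℚ)) (p : ℚ) hp0
    have hprod : ((-1 : ℚ) ^ (p / 2) * p) * ((NumberField.discr K'' : ℤ) : ℚ) =
        ((((-1 : ℤ) ^ (p / 2) * m : ℤ) : ℚ)) * (p : ℚ) ^ 2 := by
      rw [hm]; push_cast; ring
    have hAeq : A = (CA⁻¹ * ⟨C'.u, ((NumberField.discr K'' : ℤ) : ℚ) * C'.r, 0, 0⟩ * Cy) •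
        V.quadraticTwist ((((-1 : ℤ) ^ (p / 2) * m : ℤ) : ℚ)) := by
      rw [← hA, ← hC', WeierstrassCurve.quadraticTwist_smul, quadraticTwist_quadraticTwist, hprod, ← hCy, smul_smul,
        smul_smul]
    have hC₁ : (CA⁻¹ * ⟨C'.u, ((NumberField.discr K'' : ℤ) : ℚ) * C'.r, 0, 0⟩ * Cy)⁻¹ • A =
        V.quadraticTwist ((((-1 : ℤ) ^ (p / 2) * m : ℤ) : ℚ)) := by
      rw [hAeq, inv_smul_smul]
    have hord := isOrdinaryAt_of_smul_eq_quadraticTwist V A htsq hC₁ p hp2 hpt ⟨hordV.1, hordV.2⟩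
    exact ⟨hord.1, hord.2⟩
  have hqN : q ∣ W.conductorNorm ℤ :=
    (W.dvd_conductorNorm_iff_not_hasGoodReductionAtPrime q).mpr
      (not_hasGoodReductionAtPrime_of_hasMultiplicativeReductionAtPrime q hqm)
  have hsqq : IsSquare (((NumberField.discr K'' : ℤ) : ℚ) : ℚ_[q]) := hsqD q hq.out hqN hqp
  have hmultA : A.HasMultiplicativeReductionAtPrime q := (X11b.mult_iff_of_twist W hDq hsqq A hA).mpr hqm
  have hΔq : padicValInt q A.minimalDiscriminantInt = padicValInt q W.minimalDiscriminantInt :=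
    X11b.padicValInt_minimalDiscriminantInt_twist_eq W q hDq (by simpa using hsqq) CA⁻¹ hA
  refine ⟨K'', iF, iN, A, iA, iAm, ⟨hK, hpD', ?_, ?_⟩, hfree, ⟨CA⁻¹, hA⟩, hrA, hgoA, hsurjA,
    ⟨q, hq, hqp, hmultA, by rw [hΔq]; exact hqv⟩⟩
  · -- every prime of `N_E` off `d_{K''}` splits
    intro ℓ hℓ hℓN hℓD
    have hℓp : ℓ ≠ p := by rintro rfl; exact hℓD hpD'
    exact hHeeg ℓ hℓ hℓN hℓp
  · -- Birch's clause is vacuous: no prime of `N_E` other than `p` divides `d_{K''}`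
    intro ℓ hℓ hℓN hℓD hℓp
    exact absurd hℓD (hndvd ℓ hℓ hℓN hℓp)

/-! ### §2 FIELDS 2–3 given the genus-road data, Tamagawa-free given J -/

/-- **The upper half of the rank-one twin from genus-road data, Tamagawa-free given J.** For `Wd` (globally minimal) of analytic rank `1` on
cell (G-ord, `e = 2`), `p ≥ 5`, `ρ̄_{Wd,p}` onto, and genus-road data `(K″, A)` of the shape every FIELD-2 supply of the road delivers (a
`p`-ramified Kolyvagin field `RamifiedKolyvaginField Wd A p K″` with a free ramified prime; `A ≅ Wd^{(d_{K″})}` globally minimal of analytic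
rank `0`, good ordinary at `p`, `ρ̄_{A,p}` onto, with a multiplicative prime `ℓ ≠ p`, `p ∤ v_ℓ(Δ_A)`): `MissingUpperBoundAt Wd p`
(`ord_p #Ш(Wd) ≤ ord_p #Ш_an(Wd)`) — FIELD 2 := J at the data, FIELD 3 := Skinner–Urban 2014 Thm. 2 for `A`
(`AdditiveBranchIMCThreeFieldRoad.missingLowerBoundAt_rankZero_of_S30`), glue `SchneiderFree.Upper.missingUpperBoundAt_of_jointUpper_of_lower`.
NO clause `p ∤ ∏ c_ℓ`. [cite: SkinnerUrban2014, Thm. 2 (a)] [cite: Kolyvagin1990, Thm. A] -/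
theorem missingUpperBoundAt_of_genusData_tamFree
    (hJ : ∀ (Wd : WeierstrassCurve ℚ) [Wd.IsElliptic] [Wd.IsGloballyMinimal] (A : WeierstrassCurve ℚ) [A.IsElliptic]
      [A.IsGloballyMinimal] (p : ℕ) [Fact p.Prime] (K'' : Type) [Field K''] [NumberField K''],
      5 ≤ p → Wd.analyticRank = 1 → A.analyticRank = 0 → N10.CellGordTwo Wd p → Surj Wd p →
      RamifiedKolyvaginField Wd A p K'' →
      (∃ ℓ : ℕ, ℓ.Prime ∧ (ℓ : ℤ) ∣ NumberField.discr K'' ∧ ℓ ≠ p ∧ ¬ ℓ ∣ Wd.conductorNorm ℤ) →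
      (∃ C : VariableChange ℚ, C • Wd.quadraticTwist (NumberField.discr K'' : ℚ) = A) → GoodOrd A p →
      SchneiderFree.Upper.JointUpperBoundAt Wd A p)
    (hmod : hasEntireLFunction_rat) (hSUf : padicValRat_bsd_rank_zero) (hGZK : rank_eq_analyticRank_of_analyticRank_le_one)
    (Wd : WeierstrassCurve ℚ) [Wd.IsElliptic] [Wd.IsGloballyMinimal] (p : ℕ) [Fact p.Prime]
    (hp5 : 5 ≤ p) (hrd : Wd.analyticRank = 1) (hcelld : N10.CellGordTwo Wd p) (hsurjd : Surj Wd p)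
    (K'' : Type) [Field K''] [NumberField K''] (A : WeierstrassCurve ℚ) [A.IsElliptic] [A.IsGloballyMinimal]
    (hK'' : RamifiedKolyvaginField Wd A p K'')
    (hfree : ∃ ℓ : ℕ, ℓ.Prime ∧ (ℓ : ℤ) ∣ NumberField.discr K'' ∧ ℓ ≠ p ∧ ¬ ℓ ∣ Wd.conductorNorm ℤ)
    (htwA : ∃ C : VariableChange ℚ, C • Wd.quadraticTwist (NumberField.discr K'' : ℚ) = A)
    (hrA : A.analyticRank = 0) (hgoA : GoodOrd A p) (hsurjA : Surj A p)
    (hram : ∃ ℓ : ℕ, ∃ _ : Fact ℓ.Prime, ℓ ≠ p ∧ A.HasMultiplicativeReductionAtPrime ℓ ∧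
      ¬ p ∣ padicValInt ℓ A.minimalDiscriminantInt) :
    MissingUpperBoundAt Wd p := by
  -- FIELD 2 := J at the data
  have hJ'' : SchneiderFree.Upper.JointUpperBoundAt Wd A p := hJ Wd A p K'' hp5 hrd hrA hcelld hsurjd hK'' hfree htwA hgoA
  -- FIELD 3: the partner's lower half (Skinner–Urban 2014 Thm. 2 (a) by name)
  have hLA : MissingLowerBoundAt A p :=
    AdditiveBranchIMCThreeFieldRoad.missingLowerBoundAt_rankZero_of_S30 hSUf hmod hGZK A p (by omega) hrA hgoA hsurjA hram
  exact SchneiderFree.Upper.missingUpperBoundAt_of_jointUpper_of_lower hJ'' hLA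

/-! ### §3 FIELDS 2–3 for a rank-one curve with its own Skinner–Urban prime, Tamagawa-free given J -/

/-- **The upper half of a RANK-ONE curve on cell (G-ord, `e = 2`) with a Skinner–Urban prime, Tamagawa-free given J.** For `Wd` (globally
minimal) of analytic rank `1` on the cell, `p ≥ 5`, `ρ̄_{Wd,p}` onto, and a multiplicative prime `r ≠ p` of `Wd` with `p ∤ v_r(Δ_min)`:
`MissingUpperBoundAt Wd p`, from `exists_genusField_rankOne_noTam` (`w(Wd) = −1` by parity) and `missingUpperBoundAt_of_genusData_tamFree`.
The door-D / door-C shape of FIELD 2 (LeadReport28 §0). NO clause `p ∤ ∏ c_ℓ(Wd)`. [cite: SkinnerUrban2014, Thm. 2 (a)]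
[cite: HoffsteinLuo1997, Theorem (§1)] -/
theorem missingUpperBoundAt_rankOne_of_genusTamFree
    (hJ : ∀ (Wd : WeierstrassCurve ℚ) [Wd.IsElliptic] [Wd.IsGloballyMinimal] (A : WeierstrassCurve ℚ) [A.IsElliptic]
      [A.IsGloballyMinimal] (p : ℕ) [Fact p.Prime] (K'' : Type) [Field K''] [NumberField K''],
      5 ≤ p → Wd.analyticRank = 1 → A.analyticRank = 0 → N10.CellGordTwo Wd p → Surj Wd p →
      RamifiedKolyvaginField Wd A p K'' →
      (∃ ℓ : ℕ, ℓ.Prime ∧ (ℓ : ℤ) ∣ NumberField.discr K'' ∧ ℓ ≠ p ∧ ¬ ℓ ∣ Wd.conductorNorm ℤ) →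
      (∃ C : VariableChange ℚ, C • Wd.quadraticTwist (NumberField.discr K'' : ℚ) = A) → GoodOrd A p →
      SchneiderFree.Upper.JointUpperBoundAt Wd A p)
    (hnf : exists_isNewformOf) (hmod : hasEntireLFunction_rat)
    (hHL : HoffsteinLuo1997_exists_twist_L_one_ne_zero) (hSUf : padicValRat_bsd_rank_zero)
    (hGZK : rank_eq_analyticRank_of_analyticRank_le_one)
    (Wd : WeierstrassCurve ℚ) [Wd.IsElliptic] [Wd.IsGloballyMinimal] (p : ℕ) [Fact p.Prime]
    (hp5 : 5 ≤ p) (hrd : Wd.analyticRank = 1) (hcelld : N10.CellGordTwo Wd p) (hsurjd : Surj Wd p)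
    (hSUd : ∃ (r : ℕ) (_ : Fact r.Prime), r ≠ p ∧ Wd.HasMultiplicativeReductionAtPrime r ∧
      ¬ p ∣ padicValInt r Wd.minimalDiscriminantInt) :
    MissingUpperBoundAt Wd p := by
  have hpar : ∀ X : WeierstrassCurve ℚ, even_analyticRank_iff_rootNumber_eq_one X :=
    fun X ↦ even_analyticRank_iff_rootNumber_eq_one_of_exists_isNewformOf X hnf
  have hwd : Wd.rootNumber = -1 := (rootNumber_of_analyticRank_le_one Wd hpar).2 hrd
  obtain ⟨r, hrF, hrp, hmultdr, hΔdr⟩ := hSUd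
  haveI := hrF
  obtain ⟨K'', iF'', iN'', A, iA, iAm, hK'', hfree, htwA, hrA, hgoA, hsurjA, hram⟩ :=
    exists_genusField_rankOne_noTam Wd p hnf hmod hHL hp5 hwd hcelld hsurjd hrp hmultdr hΔdr
  exact missingUpperBoundAt_of_genusData_tamFree hJ hmod hSUf hGZK Wd p hp5 hrd hcelld hsurjd K'' A hK'' hfree htwA hrA hgoA hsurjA hram

end Summit.BirchSwinnertonDyer.BirchSwinnertonDyer.Theorems.GenusTamagawaFree

end
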